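import Literature.MathematicalPhysics.QuantumFieldTheory.Balaban1983to89.Node00.TorusCoverCubeDomains
import Literature.MathematicalPhysics.QuantumFieldTheory.Balaban1983to89.Node00.TorusCoverCubeMemberPrint
import Summits.QuantumFields.YangMills.Theorems.UnitScaleTiltProp8FlatCubeOpsText

/-!
# N07 [B11] — FILE 39b: THE TORUS DOMAIN FAMILY OF A PRINT CUBE IS (2.1)–(2.2)-ADMISSIBLE — `Adm22 (cubeDomains P a M ρ k hk) R M₁`
# (the S5 socket's hypothesis, so that k0-s1-w3's `body_of_adm22_T4` ∕ `hRowsAt_of_adm22_T4` read the per-cube heart on the SAME tower as N05's gauge theorems)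

Cell `pub-ymgap`, seat `pub-ymgap-dag-n07-e` generation 18 (R141 (C) s3 lineage, DAG node N07 = [15]; OFFER∕INTENT-39b, bus 2026-08-28).  Summits-side because the
admissibility predicate `FlatCubeOpsText.Adm22` of the route UnitScaleTilt lives here.  `--kind proof --supports stmt-QuantumFields-20541 --as helper`; count-neutral.
CONSUMED BY NAME, nothing modified: module 39 `Node00.TorusCoverCubeDomains` (`cubeDomains`, `cubeOm`, `exists_inner_label_of_blockOf_mem_cubeOm`, `mem_cubeDomains_Om_iff`,
`coverAt_valLift`, `coverAt_add_period`, `coverAt_eq_coverAt_iff`), n05-a's `B8Eq131CubesAdmissible.sq_blockSat` («□_j^{(j)} is a union of big blocks») and the (1.131) corners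
`B8Eq131Cubes.(sqLo, sqHi, inLo, inHi, bLo, bHi, gs, one_le_gs)`, k0-s2-w2's print class `Node00.CubeB8.IsPrint`, module 36a's `Node00.propCubeP` ∕ `isPrint_propCubeP`, ym3-torus's `FlatCubeOpsText.Adm22` and the sup circular distance
`B5Prop12FieldsLattice.distSite` on `Mk P j`.
[15] = [Balaban1985Variational]; [6] = [Balaban1985RegularSpaces]; [B6] = [Balaban1984PropagatorsII].

THE PRINT.  [B6] (2.1)–(2.2) p. 224: «Ω_j = B^j(Ω_j^{(j)}), Ω_j^{(j)} ⊂ T^{(j)} and it is a sum of big blocks, (L^jη)⁻¹dist(Ω_j^c, Ω_{j+1}) > RM»; [6] p. 98: «□ … a union of cubes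
of the size R₁M₁Lʲη … M is a multiple of R₁M₁ … a distance between boundaries of these cubes is equal to R₁M₁Lʲη … □_j is a sum of the big blocks of the lattice
T_{L^{−j}}»; [15] (144) p. 300: «dist(□_{n+1}, □ᶜ_n) = R₁M₁Lⁿη».  ym3-torus's typing `Adm22 D R M` (`UnitScaleTiltProp8FlatCubeOpsText`): (2.1) «membership in `Ω_j^{(j)}`,
`j ≥ 1`, depends only on the `M`-labels `⌊y_μ∕M⌋` of the torus site» and (2.2) «a `j`-block inside `Ω_{j+1}` and a `j`-site outside `Ω_j` are `> R·M` apart in the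
sup circular distance».

WHAT IS PROVED (kernel; every `Params`; block ∕ residue arithmetic — NO estimate of Bałaban).
§1 `sitesPerDir_eq_pow_mul` (`sitesPerDir j = L^{k−j}·sitesPerDir k`), `dvd_sitesPerDir_of_dvd` (`M₁ ∣ sitesPerDir k ⇒ M₁ ∣ sitesPerDir j`, `j ≤ k`), `inLo_eq_sqLo_add` ∕
   `inHi_eq_sqHi_sub` (the inner box of `Λ′_j` is the outer one shrunk by EXACTLY `ρ` — print's «distance … equal to R₁M₁Lʲη»).
§2 ★★ `cubeDomains_bigBlocks` — (2.1) for `cubeDomains`: if `M₁ ∣ ρ`, `M₁ ∣ a_i`, `M₁ ∣ M` (print's class `CubeB8.IsPrint M₁`) AND `M₁ ∣ sitesPerDir k` (the big blocks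
   tile the level tori — print's standing arrangement «M₁ a power of L»), membership in `Ω_j^{(j)}` depends only on the `M₁`-labels (via `sq_blockSat` and a deck translation).
§3 ★★ `cubeDomains_sep` — (2.2) for `cubeDomains` with ANY `R` such that `R·M₁ ≤ ρ`: a `j`-block inside `Ω_{j+1}` has a label in `□_{j+1}^{(j)} = [sqLo + ρ, sqHi − ρ]`
   (module 39), a site outside `Ω_j` has every label outside `[sqLo, sqHi]`, so their circular distance is `≥ ρ + 1 > R·M₁` — NO non-wrapping hypothesis needed.
§4 ★★★ `adm22_cubeDomains` and the datum form ★★★ `adm22_cubeDomains_of_isPrint` (`c : CubeB8 P.d P.L K Ω′` with `c.IsPrint M₁`, `M₁ ∣ sitesPerDir c.k`, `R·M₁ ≤ c.ρ`).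
§5 ★ `inOm_cubeDomains_of_mem_cube` ∕ ★ `inOm_top_cubeDomains_of_mem_box` (the grid cube `□ = box` lies over the top domain `Ω_k`: the token window's bonds get level weight `1`).
§6 ★★ `adm22_cubeDomains_propCubeP` — the instance at module 36a's print datum `propCubeP` of a grid cube (`IsPrint ρ`): every `M₁ ∣ ρ` with `M₁ ∣ sitesPerDir n`, `R·M₁ ≤ ρ`.
HONEST FRAMING: count-neutral helper; bookkeeping about the tree's own objects; nothing of [15]∕[6]∕[B6] analysis asserted; the tokens ∕ stub 1 ∕ K0⁷ NOT closed; N07 NOT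
discharged (5∕27 unmoved); one finite T⁴ programme at fixed ε — R4 closes rung `BalabanLadder.UV` only; NOT continuum ∕ ℝ⁴ ∕ OS ∕ mass gap ∕ Clay.  No `sorry`, no `def`.
-/

noncomputable section

namespace Summit.QuantumFields.YangMills.BalabanUVNodes.N07CubeDomainsAdm22

open Literature.MathematicalPhysics.QuantumFieldTheory.Balaban1983to89
open Node00 (coverAt coverAt_apply cubeDomains cubeOm exists_inner_label_of_blockOf_mem_cubeOm mem_cubeDomains_Om_iff coverAt_valLift coverAt_add_period
  coverAt_eq_coverAt_iff labelBox mem_labelBox CubeB8)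
open B5Eq117TorusCarriers (Mk)
open B5Prop12FieldsLattice (distSite)
open B7Prop1Local (InBox)
open B8Eq131Cubes (sqLo sqHi inLo inHi bLo bHi gs one_le_gs)
open B8Eq131CubesAdmissible (sq_blockSat)
open B14DomainGeom (Pt)
open Literature.MathematicalPhysics.QuantumLattice (blockMap)
open Summit.QuantumFields.YangMills.Theorems.FlatCubeOpsText (Adm22)

variable {P : Params}

/-! ## §1  Period and corner arithmetic -/

/-- `sitesPerDir j = L^{k−j} · sitesPerDir k` (`j ≤ k ≤ m + K`). [cite: Balaban1987RG1, (0.1) p.251] -/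
theorem sitesPerDir_eq_pow_mul {j k : ℕ} (hjk : j ≤ k) (hk : k ≤ P.m + P.K) : P.sitesPerDir j = P.L ^ (k - j) * P.sitesPerDir k := by
  simp only [Params.sitesPerDir]
  rw [mul_left_comm, ← pow_add]
  congr 2
  omega

/-- If the big block tiles the level-`k` torus it tiles every finer level: `M₁ ∣ sitesPerDir k ⇒ M₁ ∣ sitesPerDir j` (`j ≤ k ≤ m + K`). [cite: Balaban1984PropagatorsII, (2.1) p.224] -/
theorem dvd_sitesPerDir_of_dvd {M₁ j k : ℕ} (hjk : j ≤ k) (hk : k ≤ P.m + P.K) (h : M₁ ∣ P.sitesPerDir k) : M₁ ∣ P.sitesPerDir j := by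
  rw [sitesPerDir_eq_pow_mul hjk hk]
  exact dvd_mul_of_dvd_right h _

/-- **The inner box is the outer box shrunk by exactly `ρ`** (lower corners): `inLo j = sqLo j + ρ` — print's «dist(□_{n+1}, □ᶜ_n) = R₁M₁Lⁿη».
[cite: Balaban1985Variational, (144) p.300; Balaban1985RegularSpaces, p.98] -/
theorem inLo_eq_sqLo_add (L : ℕ) (a : Pt P.d) (ρ k j : ℕ) (i : Fin P.d) : inLo L a ρ k j i = sqLo L a ρ k j i + ρ := by
  have h := one_le_gs L (k - j)
  have e : ((ρ * (gs L (k - j) - 1) : ℕ) : ℤ) = (ρ * gs L (k - j) : ℕ) - ρ := by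
    rw [Nat.mul_sub, Nat.mul_one, Nat.cast_sub (Nat.le_mul_of_pos_right _ h)]
  rw [show inLo L a ρ k j i = (L : ℤ) ^ (k - j) * a i - ((ρ * (gs L (k - j) - 1) : ℕ) : ℤ) from rfl,
    show sqLo L a ρ k j i = (L : ℤ) ^ (k - j) * a i - ((ρ * gs L (k - j) : ℕ) : ℤ) from rfl, e]
  ring

/-- **The inner box is the outer box shrunk by exactly `ρ`** (upper corners): `inHi j = sqHi j − ρ`. [cite: Balaban1985Variational, (144) p.300; Balaban1985RegularSpaces, p.98] -/
theorem inHi_eq_sqHi_sub (L : ℕ) (a : Pt P.d) (M ρ k j : ℕ) (i : Fin P.d) : inHi L a M ρ k j i = sqHi L a M ρ k j i - ρ := by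
  have h := one_le_gs L (k - j)
  have e : ((ρ * (gs L (k - j) - 1) : ℕ) : ℤ) = (ρ * gs L (k - j) : ℕ) - ρ := by
    rw [Nat.mul_sub, Nat.mul_one, Nat.cast_sub (Nat.le_mul_of_pos_right _ h)]
  rw [show inHi L a M ρ k j i = (L : ℤ) ^ (k - j) * (a i + (M : ℤ)) - 1 + ((ρ * (gs L (k - j) - 1) : ℕ) : ℤ) from rfl,
    show sqHi L a M ρ k j i = (L : ℤ) ^ (k - j) * (a i + (M : ℤ)) - 1 + ((ρ * gs L (k - j) : ℕ) : ℤ) from rfl, e]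
  ring

/-! ## §2  (2.1): the family is a union of big blocks -/

section BigBlocks

variable {a : Pt P.d} {M ρ k : ℕ} {hk : k ≤ P.m + P.K}

/-- One direction of (2.1) for `cubeDomains`: a site with the `M₁`-labels of a member is a member (`1 ≤ j ≤ k`). [cite: Balaban1984PropagatorsII, (2.1) p.224; Balaban1985RegularSpaces, p.98] -/
theorem mem_cubeDomains_Om_of_sameBlock {M₁ : ℕ} (hM₁ : 1 ≤ M₁) (hρ : M₁ ∣ ρ) (ha : ∀ i, (M₁ : ℤ) ∣ a i) (hM : M₁ ∣ M)
    (hperk : M₁ ∣ P.sitesPerDir k) {j : ℕ} (hj : 1 ≤ j) (hjk : j ≤ k) {y y' : Site P j}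
    (h : ∀ μ, (y μ).val / M₁ = (y' μ).val / M₁) (hy : y ∈ (cubeDomains P a M ρ k hk).Om j) : y' ∈ (cubeDomains P a M ρ k hk).Om j := by
  rw [mem_cubeDomains_Om_iff hj hjk] at hy ⊢
  obtain ⟨s, hs, hse⟩ := hy
  -- `s ≡ val y (mod period)`: `val y − s = period · q`
  have hcov : coverAt P j s = coverAt P j (fun μ => ((y μ).val : ℤ)) := hse.trans (coverAt_valLift j y).symm
  have hdvd := (coverAt_eq_coverAt_iff j s _).1 hcov
  choose q hq using hdvd
  obtain ⟨p', hp'⟩ := dvd_sitesPerDir_of_dvd hjk hk hperk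
  -- the label of `y'` in the same deck sheet as `s`
  refine ⟨(fun μ => ((y' μ).val : ℤ)) + fun μ => ((P.sitesPerDir j : ℕ) : ℤ) * (-q μ), ?_, ?_⟩
  · refine sq_blockSat hM₁ hρ ha hM ?_ hs
    funext μ
    have hs' : s μ = ((y μ).val : ℤ) + ((P.sitesPerDir j : ℕ) : ℤ) * (-q μ) := by linarith [hq μ]
    simp only [blockMap, Pi.add_apply, hs', hp']
    push_cast
    have hM0 : (M₁ : ℤ) ≠ 0 := by exact_mod_cast (by omega : M₁ ≠ 0)
    rw [show ((y μ).val : ℤ) + (M₁ : ℤ) * (p' : ℤ) * -q μ = ((y μ).val : ℤ) + (M₁ : ℤ) * ((p' : ℤ) * -q μ) by ring,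
      show ((y' μ).val : ℤ) + (M₁ : ℤ) * (p' : ℤ) * -q μ = ((y' μ).val : ℤ) + (M₁ : ℤ) * ((p' : ℤ) * -q μ) by ring,
      Int.add_mul_ediv_left _ _ hM0, Int.add_mul_ediv_left _ _ hM0]
    have h1 : ((y μ).val : ℤ) / (M₁ : ℤ) = (((y μ).val / M₁ : ℕ) : ℤ) := (Int.natCast_div _ _).symm
    have h2 : ((y' μ).val : ℤ) / (M₁ : ℤ) = (((y' μ).val / M₁ : ℕ) : ℤ) := (Int.natCast_div _ _).symm
    rw [h1, h2, h μ]
  · rw [coverAt_add_period, coverAt_valLift]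

/-- ★★ **(2.1) FOR `cubeDomains`**: at every positive level membership depends only on the `M₁`-labels — for a print cube (`M₁ ∣ ρ`, `M₁ ∣ a_i`, `M₁ ∣ M`) whose big block
tiles the level-`k` torus (`M₁ ∣ sitesPerDir k`). [cite: Balaban1984PropagatorsII, (2.1) p.224; Balaban1985RegularSpaces, p.98 («□_j is a sum of the big blocks of the lattice T_{L^{−j}}»)] -/
theorem cubeDomains_bigBlocks {M₁ : ℕ} (hM₁ : 1 ≤ M₁) (hρ : M₁ ∣ ρ) (ha : ∀ i, (M₁ : ℤ) ∣ a i) (hM : M₁ ∣ M) (hperk : M₁ ∣ P.sitesPerDir k) :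
    ∀ j, 1 ≤ j → ∀ y y' : Site P j, (∀ μ, (y μ).val / M₁ = (y' μ).val / M₁) →
      (y ∈ (cubeDomains P a M ρ k hk).Om j ↔ y' ∈ (cubeDomains P a M ρ k hk).Om j) := by
  intro j hj y y' h
  rcases Nat.lt_or_ge k j with hkj | hjk
  · rw [(cubeDomains P a M ρ k hk).Om_eq_empty hkj]; simp
  · exact ⟨mem_cubeDomains_Om_of_sameBlock hM₁ hρ ha hM hperk hj hjk h,
      mem_cubeDomains_Om_of_sameBlock hM₁ hρ ha hM hperk hj hjk fun μ => (h μ).symm⟩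

end BigBlocks

/-! ## §3  (2.2): the separation `> R·M₁` -/

section Separation

variable {a : Pt P.d} {M ρ k : ℕ} {hk : k ≤ P.m + P.K}

/-- A label whose cover is `y′` and which differs from a given label `s` (covering `y`) by the minimal residues of `y′ − y`. [cite: Balaban1987RG1, (0.1) p.251 (bookkeeping)] -/
theorem coverAt_add_valMinAbs {j : ℕ} {s : Pt P.d} {y : Site P j} (hs : coverAt P j s = y) (y' : Site P j) :
    coverAt P j (s + fun μ => ((y' μ - y μ).valMinAbs : ℤ)) = y' := by
  funext μ
  have hμ := congrFun hs μ
  simp only [coverAt_apply, Pi.add_apply, Int.cast_add, ZMod.coe_valMinAbs] at hμ ⊢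
  rw [hμ]; abel

/-- ★★ **(2.2) FOR `cubeDomains`** with any `R` such that `R·M₁ ≤ ρ`: a `j`-block inside `Ω_{j+1}` and a `j`-site outside `Ω_j` are more than `R·M₁` apart in the sup circular
distance of `T^{(j)}` — the collar `Λ′_j` has width EXACTLY `ρ` in level-`j` units. [cite: Balaban1984PropagatorsII, (2.2) p.224; Balaban1985Variational, (144) p.300; Balaban1985RegularSpaces, (1.4) p.77, p.98] -/
theorem cubeDomains_sep {R M₁ : ℕ} (hRρ : R * M₁ ≤ ρ) :
    ∀ j, ∀ y y' : Site P j, blockOf y ∈ (cubeDomains P a M ρ k hk).Om (j + 1) → y' ∉ (cubeDomains P a M ρ k hk).Om j →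
      ((R * M₁ : ℕ) : ℝ) < distSite (Mk P j) y y' := by
  intro j y y' hy hy'
  rcases Nat.eq_zero_or_pos j with rfl | hj
  · exact absurd (by rw [Node00.cubeDomains_Om_zero]; exact Finset.mem_univ _) hy'
  have hjk : j < k := by
    by_contra hc
    rw [(cubeDomains P a M ρ k hk).Om_eq_empty (by omega : k < j + 1)] at hy
    exact absurd hy (Finset.notMem_empty _)
  obtain ⟨s, hs, hse⟩ := exists_inner_label_of_blockOf_mem_cubeOm hk hj hjk hy
  set δ : Pt P.d := fun μ => ((y' μ - y μ).valMinAbs : ℤ) with hδ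
  have hcov : coverAt P j (s + δ) = y' := coverAt_add_valMinAbs hse y'
  -- the shifted label is outside `□_j^{(j)}`
  have hout : ¬ InBox (sqLo P.L a ρ k j) (sqHi P.L a M ρ k j) (s + δ) := fun hin =>
    hy' ((mem_cubeDomains_Om_iff hj hjk.le _).2 ⟨s + δ, hin, hcov⟩)
  simp only [InBox, not_forall, not_and_or, not_le, Pi.add_apply] at hout
  obtain ⟨μ, hμ⟩ := hout
  obtain ⟨h1, h2⟩ := hs μ
  rw [inLo_eq_sqLo_add] at h1
  rw [inHi_eq_sqHi_sub] at h2
  -- `|δ μ| ≥ ρ + 1`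
  have hbig : (ρ : ℤ) + 1 ≤ |δ μ| := by
    rcases hμ with h | h
    · rw [abs_of_neg (by linarith)]; linarith
    · rw [abs_of_pos (by linarith)]; linarith
  have hnat : ρ + 1 ≤ ((y μ - y' μ).valMinAbs).natAbs := by
    rw [← neg_sub, ZMod.natAbs_valMinAbs_neg]
    have : ((ρ + 1 : ℕ) : ℤ) ≤ (((y' μ - y μ).valMinAbs).natAbs : ℤ) := by
      rw [Int.natCast_natAbs]; exact_mod_cast hbig
    exact_mod_cast this
  have hsup : ρ + 1 ≤ Finset.univ.sup fun ν : Fin P.d => ((y ν - y' ν).valMinAbs).natAbs :=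
    hnat.trans (Finset.le_sup (f := fun ν : Fin P.d => ((y ν - y' ν).valMinAbs).natAbs) (Finset.mem_univ μ))
  unfold distSite
  have hcast : ((ρ + 1 : ℕ) : ℝ) ≤ ((Finset.univ.sup fun ν : Fin P.d => ((y ν - y' ν).valMinAbs).natAbs : ℕ) : ℝ) := by exact_mod_cast hsup
  have hR : ((R * M₁ : ℕ) : ℝ) < ((ρ + 1 : ℕ) : ℝ) := by exact_mod_cast Nat.lt_succ_of_le hRρ
  exact hR.trans_le hcast

end Separation

/-! ## §4  Admissibility -/

section Admissible

variable {a : Pt P.d} {M ρ k : ℕ} {hk : k ≤ P.m + P.K}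

/-- ★★★ **THE TORUS DOMAIN FAMILY OF A PRINT CUBE IS (2.1)–(2.2)-ADMISSIBLE**: `Adm22 (cubeDomains P a M ρ k hk) R M₁` for a print cube at big-block size `M₁` (`M₁ ∣ ρ`,
`M₁ ∣ a_i`, `M₁ ∣ M`), `M₁ ∣ sitesPerDir k`, and every separation `R` with `R·M₁ ≤ ρ` (print: `ρ = R₁M₁`, `R ≤ R₁`).
[cite: Balaban1984PropagatorsII, (2.1)–(2.2) p.224; Balaban1985RegularSpaces, (1.3)–(1.4) p.77, p.98; Balaban1985Variational, (144) p.300] -/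
theorem adm22_cubeDomains {R M₁ : ℕ} (hM₁ : 1 ≤ M₁) (hρ : M₁ ∣ ρ) (ha : ∀ i, (M₁ : ℤ) ∣ a i) (hM : M₁ ∣ M) (hperk : M₁ ∣ P.sitesPerDir k)
    (hRρ : R * M₁ ≤ ρ) : Adm22 (cubeDomains P a M ρ k hk) R M₁ :=
  ⟨cubeDomains_bigBlocks hM₁ hρ ha hM hperk, cubeDomains_sep hRρ⟩

variable {K : ℕ} {Ω' : ℕ → Set (Pt P.d)}

/-- ★★★ **THE DATUM FORM**: for a `CubeB8` datum `c` in print's class at big-block size `M₁` (`c.IsPrint M₁`), with `M₁ ∣ sitesPerDir c.k` and `R·M₁ ≤ c.ρ`, the torus family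
`cubeDomains P c.a c.M c.ρ c.k hk` is `Adm22 … R M₁` — the hypothesis of k0-s1-w3's `body_of_adm22_T4` ∕ `hRowsAt_of_adm22_T4` AT THE TOWER OF THE GAUGE THEOREMS.
[cite: Balaban1984PropagatorsII, (2.1)–(2.2) p.224; Balaban1985RegularSpaces, p.98; Balaban1985Variational, (144) p.300] -/
theorem adm22_cubeDomains_of_isPrint (c : CubeB8 P.d P.L K Ω') (hck : c.k ≤ P.m + P.K) {R M₁ : ℕ} (hM₁ : 1 ≤ M₁) (hP : c.IsPrint M₁)
    (hperk : M₁ ∣ P.sitesPerDir c.k) (hRρ : R * M₁ ≤ c.ρ) : Adm22 (cubeDomains P c.a c.M c.ρ c.k hck) R M₁ :=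
  adm22_cubeDomains hM₁ hP.rho_dvd hP.corner_dvd hP.side_dvd hperk hRρ

end Admissible


/-! ## §5  The token's window: bonds and plaquettes based in `□ = box` lie in the top domain of the family -/

section Window

variable {a : Pt P.d} {M ρ k : ℕ} {hk : k ≤ P.m + P.K}

/-- ★ **A FINE POINT OF `□_j` COVERS A POINT OF `Ω_j`** (`1 ≤ j ≤ k`, `π` injective on `□₀`): in particular every point of the grid cube `□ = box L a M k ⊆ □_k` covers a point of
the TOP domain `Ω_k` of `cubeDomains` — so the S5 rows' level weights evaluate to `1` on bonds based in `π '' □` (ym3-torus's `levWeight_eq_one_of_inOm_top` pattern).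
[cite: Balaban1985RegularSpaces, (1.131) p.99, p.98 («□_k, □»); Balaban1985Variational, (144) p.300] -/
theorem inOm_cubeDomains_of_mem_cube (hinj : Set.InjOn (B15Eq112TorusCover.cover P) (B8Eq131Cubes.cube P.L a M ρ k 0)) {j : ℕ} (hj : 1 ≤ j) (hjk : j ≤ k)
    {x : Pt P.d} (hx : x ∈ B8Eq131Cubes.cube P.L a M ρ k j) : (cubeDomains P a M ρ k hk).InOm j (B15Eq112TorusCover.cover P x) :=
  (Node00.inOm_cubeDomains_cover_iff hinj hj hjk (B8Eq131Cubes.cube_anti (Nat.zero_le j) hjk hx)).2 hx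

/-- ★ **THE GRID CUBE LIES OVER THE TOP DOMAIN**: `x ∈ box L a M k ⇒ π x ∈ Ω_k` (`1 ≤ k`, `π` injective on `□₀`). [cite: Balaban1985RegularSpaces, p.98 («□_k, □, such that □_j ⊃ □_{j+1}»); Balaban1985Variational, (144) p.300] -/
theorem inOm_top_cubeDomains_of_mem_box (hinj : Set.InjOn (B15Eq112TorusCover.cover P) (B8Eq131Cubes.cube P.L a M ρ k 0)) (hk1 : 1 ≤ k) {x : Pt P.d}
    (hx : x ∈ B8Eq131Cubes.box P.L a M k) : (cubeDomains P a M ρ k hk).InOm k (B15Eq112TorusCover.cover P x) :=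
  inOm_cubeDomains_of_mem_cube hinj hk1 le_rfl (B8Eq131Cubes.box_subset_cube_top P.L a M ρ k hx)

end Window


/-! ## §6  The print datum of a grid cube -/

section PrintDatum

/-- ★★ **THE PRINT DATUM's TORUS FAMILY IS ADMISSIBLE**: for the (144)∕p. 98 datum `propCubeP P n hn M ρ hρ a` of a grid cube (module 36a: corner on the `ρ`-grid, side a multiple of `ρ`,
collar `ρ`), every big-block size `M₁ ∣ ρ` tiling the level-`n` torus and every `R` with `R·M₁ ≤ ρ` give `Adm22 (cubeDomains …) R M₁` — print's `ρ = R₁M₁`, `R ≤ R₁`.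
[cite: Balaban1985RegularSpaces, p.98 («M is a multiple of R₁M₁ … □_j is a sum of the big blocks»); Balaban1984PropagatorsII, (2.1)–(2.2) p.224; Balaban1985Variational, (144) p.300] -/
theorem adm22_cubeDomains_propCubeP (n : ℕ) (hn : 1 ≤ n) (hnK : n ≤ P.m + P.K) (M ρ : ℕ) (hρ : P.L ≤ ρ) (a : Pt P.d) {R M₁ : ℕ} (hM₁ : 1 ≤ M₁)
    (hM₁ρ : M₁ ∣ ρ) (hper : M₁ ∣ P.sitesPerDir n) (hR : R * M₁ ≤ ρ) :
    Adm22 (cubeDomains P (Node00.propCubeP P n hn M ρ hρ a).a (Node00.propCubeP P n hn M ρ hρ a).M (Node00.propCubeP P n hn M ρ hρ a).ρ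
      (Node00.propCubeP P n hn M ρ hρ a).k hnK) R M₁ :=
  adm22_cubeDomains_of_isPrint _ hnK hM₁ ((Node00.isPrint_propCubeP P n hn M ρ hρ a).of_dvd hM₁ρ) hper hR

end PrintDatum

end Summit.QuantumFields.YangMills.BalabanUVNodes.N07CubeDomainsAdm22

end
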